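import Literature.NumberTheory.EllipticCurves.KatzPAdicLFunctionCMField
import Literature.NumberTheory.Automorphic.IdeleIdealClass
import Literature.IUT.LogVolume.DifferentExponentOreBoundNumberField
import Literature.IUT.LogVolume.PrincipalArithmeticDivisors
import HarnessLib

/-!
# Local data of Katz's measure: the API of `ordAt` and `differentExponentAt` (Hsieh's (d2))

PROOF-ONLY companion of `Literature/NumberTheory/EllipticCurves/KatzPAdicLFunctionCMField.lean` §4
(`ordAt v x := count_v (x)` and `differentExponentAt v := count_v 𝒟_{K/ℚ}`, the two integers in which
Hsieh's hypothesis (d2) `ord_w(2ϑ) = ord_w(𝒟_{L/ℚ})` of the named fact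
`hsieh2014mu_prop49_exists_isMeasure` / `KatzCM.exists_isBaseChangeLine` is typed). Nothing is
asserted: no definition, no named fact, no `sorry`. Purpose (route `BiquadraticEisensteinDescent`, crux
stmt-BirchSwinnertonDyer-21341 `EisensteinHeartFlatCMInertBadKPrime`, line `hsieh-lambda`, layer 2,
instantiation of the V2 socket at the biquadratic CM field `L = K′(√d_CM)`, memo
`Cruxes/EisensteinHeartFlatCMInertBadKPrime/INSTANTIATION-L-BIQUADRATIC.md` §ADDENDUM 3): to DISCHARGE
(d2) for an explicit `ϑ` one needs exactly the dictionary below.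

* §1 `ordAt_eq_ord` — `ordAt v x` IS the tree's normalised valuation `IUT.LogVolume.ord K v x`
  (`= −log |x|_v`; both junk `0` at `x = 0`); hence `ordAt_mul`, `ordAt_inv`, `ordAt_pow`,
  `ordAt_nonneg_of_isIntegral`, `ordAt_pos_iff_mem`, `ordAt_eq_zero_iff_not_mem` (units at `v`),
  `ordAt_natCast_eq_ramificationIdx` (`ord_v(p) = e(v|p)`), `ordAt_natCast_eq_zero` (`ord_v(n) = 0` for
  `n` prime to `v`), `ordAt_algebraMap` (`ord_w(x) = e(w|v)·ord_v(x)` in a tower).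
* §2 `count_coeIdeal_eq_multiplicity`, `differentExponentAt_eq_multiplicity` — `differentExponentAt v`
  is the multiplicity of `v` in `differentIdeal ℤ (𝓞 K)`; `differentExponentAt_nonneg`.
* §3 `differentExponentAt_eq_zero_iff_isUnramifiedAt` / `…_iff_ramificationIdx_eq_one` — Dedekind:
  `d_v = 0 ⟺ v` unramified over `ℤ ⟺ e(v|p) = 1` (Mathlib `not_dvd_differentIdeal_iff`,
  `Ideal.ramificationIdx_eq_one_iff`).
* §4 `differentExponentAt_eq_one_of_ramificationIdx_eq_two` — TAME QUADRATIC RAMIFICATION: `e(v|p) = 2`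
  at an odd `p` ⟹ `d_v = 1` (lower bound Mathlib `pow_sub_one_dvd_differentIdeal`, upper bound the
  tree's Ore bound `IUT.LogVolume.multiplicity_differentIdeal_le_ore`: `d_v ≤ e − 1 + e·v_p(e) = 1`).
* §5 `differentExponentAt_eq_of_isUnramifiedAt` — TOWER STEP: for number fields `K ⊆ L` and `w ∣ v`
  with `L/K` unramified at `w`, `d_w(L/ℚ) = d_v(K/ℚ)` (Mathlib's transitivity
  `differentIdeal_eq_differentIdeal_mul_differentIdeal` + `emultiplicity_map_eq_ramificationIdx'_mul`
  + `e(w|v) = 1`); in general `d_w(L/ℚ) = d_w(L/K) + e(w|v)·d_v(K/ℚ)`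
  (`differentExponentAt_eq_add_mul`).

References: [cite: NeukirchANT1999, Ch. III §2 (the different: (2.2) multiplicativity in towers,
(2.6) `𝔓 ∣ 𝔇 ⟺ 𝔓` ramified, tame exponent `e − 1`)]; [cite: SerreLocalFields1979, Ch. III §6
Prop. 13 and Remark]; [cite: Hsieh2014mu, §3.1 (d1) (d2)].
-/

set_option autoImplicit false

noncomputable section

open scoped nonZeroDivisors NumberField

namespace Literature.NumberTheory.EllipticCurves

open NumberField IsDedekindDomain FractionalIdeal

variable {K : Type} [Field K] [NumberField K]

/-! ## §1 `ordAt` is the normalised valuation `ord` -/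

/-- `ordAt v x = ord_v(x) = −log |x|_v` (the tree's `IUT.LogVolume.ord`; both sides are the junk value
`0` at `x = 0`). [cite: NeukirchANT1999, Ch. I §11 (valuations attached to prime ideals)] -/
theorem ordAt_eq_ord (v : HeightOneSpectrum (𝓞 K)) (x : K) :
    ordAt v x = Literature.IUT.LogVolume.ord K v x := by
  by_cases hx : x = 0
  · subst hx
    rw [Literature.IUT.LogVolume.ord_zero]
    unfold ordAt
    rw [spanSingleton_zero, count_zero]
  · unfold ordAt Literature.IUT.LogVolume.ord
    exact Literature.NumberTheory.Automorphic.FractionalIdeal.count_spanSingleton_eq_neg_log_valuation v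
      (Units.mk0 x hx)

/-- `ord_v(0) = 0` (junk value of both sides). [cite: NeukirchANT1999, Ch. I §11 (valuations attached to prime ideals)] -/
theorem ordAt_zero (v : HeightOneSpectrum (𝓞 K)) : ordAt v (0 : K) = 0 := by
  rw [ordAt_eq_ord, Literature.IUT.LogVolume.ord_zero]

/-- `ord_v(1) = 0`. [cite: NeukirchANT1999, Ch. I §11 (valuations attached to prime ideals)] -/
theorem ordAt_one (v : HeightOneSpectrum (𝓞 K)) : ordAt v (1 : K) = 0 := by
  rw [ordAt_eq_ord, Literature.IUT.LogVolume.ord_one]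

/-- `ord_v(xy) = ord_v(x) + ord_v(y)` for `x, y ≠ 0`. [cite: NeukirchANT1999, Ch. I §11] -/
theorem ordAt_mul (v : HeightOneSpectrum (𝓞 K)) {x y : K} (hx : x ≠ 0) (hy : y ≠ 0) :
    ordAt v (x * y) = ordAt v x + ordAt v y := by
  simp only [ordAt_eq_ord]
  exact Literature.IUT.LogVolume.ord_mul K v hx hy

/-- `ord_v(x⁻¹) = −ord_v(x)`. [cite: NeukirchANT1999, Ch. I §11] -/
theorem ordAt_inv (v : HeightOneSpectrum (𝓞 K)) (x : K) : ordAt v x⁻¹ = -ordAt v x := by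
  simp only [ordAt_eq_ord]
  exact Literature.IUT.LogVolume.ord_inv K v x

/-- `ord_v(xⁿ) = n·ord_v(x)`. [cite: NeukirchANT1999, Ch. I §11] -/
theorem ordAt_pow (v : HeightOneSpectrum (𝓞 K)) (x : K) (n : ℕ) : ordAt v (x ^ n) = n * ordAt v x := by
  simp only [ordAt_eq_ord]
  exact Literature.IUT.LogVolume.ord_pow K v x n

/-- Integers have `ord_v ≥ 0`. [cite: NeukirchANT1999, Ch. I §11] -/
theorem ordAt_nonneg_of_isIntegral (v : HeightOneSpectrum (𝓞 K)) (x : 𝓞 K) : 0 ≤ ordAt v (x : K) := by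
  rw [ordAt_eq_ord]
  exact Literature.IUT.LogVolume.ord_nonneg_of_isIntegral K v x

/-- An integer `x ≠ 0` has `ord_v(x) > 0` iff `x ∈ v`. [cite: NeukirchANT1999, Ch. I §11] -/
theorem ordAt_pos_iff_mem (v : HeightOneSpectrum (𝓞 K)) {x : 𝓞 K} (hx : x ≠ 0) :
    0 < ordAt v (x : K) ↔ x ∈ v.asIdeal := by
  rw [ordAt_eq_ord]
  exact Literature.IUT.LogVolume.ord_pos_iff_mem K v x hx

/-- An integer `x ≠ 0` has `ord_v(x) = 0` iff `x ∉ v` (i.e. `x` is a unit at `v`).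
[cite: NeukirchANT1999, Ch. I §11] -/
theorem ordAt_eq_zero_iff_not_mem (v : HeightOneSpectrum (𝓞 K)) {x : 𝓞 K} (hx : x ≠ 0) :
    ordAt v (x : K) = 0 ↔ x ∉ v.asIdeal := by
  rw [← ordAt_pos_iff_mem v hx, not_lt]
  exact ⟨fun h ↦ h.le, fun h ↦ le_antisymm h (ordAt_nonneg_of_isIntegral v x)⟩

/-- A unit of `𝓞 K` has `ord_v = 0` everywhere. [cite: NeukirchANT1999, Ch. I §11] -/
theorem ordAt_coe_unit (v : HeightOneSpectrum (𝓞 K)) (u : (𝓞 K)ˣ) : ordAt v ((u : 𝓞 K) : K) = 0 :=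
  (ordAt_eq_zero_iff_not_mem v u.ne_zero).mpr
    fun h ↦ v.isPrime.ne_top (Ideal.eq_top_of_isUnit_mem _ h u.isUnit)

omit [NumberField K] in
/-- A prime `v ∋ p` of `𝓞 K` lies over `pℤ` (`v ∩ ℤ` is a prime ideal containing the maximal ideal `pℤ`).
[cite: NeukirchANT1999, Ch. I §8 (primes lying over `p`)] -/
theorem under_int_eq_span_of_natCast_mem {p : ℕ} (hp : p.Prime) (v : HeightOneSpectrum (𝓞 K))
    (hv : ((p : ℕ) : 𝓞 K) ∈ v.asIdeal) : v.asIdeal.under ℤ = Ideal.span {(p : ℤ)} := by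
  have hpZ : Prime (p : ℤ) := Nat.prime_iff_prime_int.mp hp
  have hmax : (Ideal.span {(p : ℤ)}).IsMaximal :=
    ((Ideal.span_singleton_prime hpZ.ne_zero).mpr hpZ).isMaximal (by simpa using hpZ.ne_zero)
  have hprime : (v.asIdeal.under ℤ).IsPrime := Ideal.IsPrime.under ℤ v.asIdeal
  refine (hmax.eq_of_le hprime.ne_top ?_).symm
  rw [Ideal.span_singleton_le_iff_mem, Ideal.mem_comap]
  simpa using hv

omit [NumberField K] in
/-- `v ∋ p` lies over `pℤ` (instance form). [cite: NeukirchANT1999, Ch. I §8 (primes lying over `p`)] -/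
theorem liesOver_span_of_natCast_mem {p : ℕ} (hp : p.Prime) (v : HeightOneSpectrum (𝓞 K))
    (hv : ((p : ℕ) : 𝓞 K) ∈ v.asIdeal) : v.asIdeal.LiesOver (Ideal.span {(p : ℤ)}) :=
  ⟨(under_int_eq_span_of_natCast_mem hp v hv).symm⟩

/-- **`ord_v(p) = e(v|p)`** at a place `v ∋ p` (both are the multiplicity of `v` in `p𝓞_K`).
[cite: NeukirchANT1999, Ch. I §8] -/
theorem ordAt_natCast_eq_ramificationIdx {p : ℕ} (hp : p.Prime) (v : HeightOneSpectrum (𝓞 K))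
    (hv : ((p : ℕ) : 𝓞 K) ∈ v.asIdeal) : ordAt v (p : K) = v.asIdeal.ramificationIdx ℤ := by
  have hp0 : ((p : ℕ) : 𝓞 K) ≠ 0 := by exact_mod_cast hp.ne_zero
  have hmap : Ideal.map (algebraMap ℤ (𝓞 K)) (Ideal.span {(p : ℤ)}) = Ideal.span {((p : ℕ) : 𝓞 K)} := by
    rw [Ideal.map_span, Set.image_singleton, map_natCast]
  have hne : Ideal.map (algebraMap ℤ (𝓞 K)) (Ideal.span {(p : ℤ)}) ≠ ⊥ := by
    rw [hmap, Ne, Ideal.span_singleton_eq_bot]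
    exact hp0
  haveI := liesOver_span_of_natCast_mem hp v hv
  rw [Ideal.IsDedekindDomain.ramificationIdx_eq_multiplicity (Ideal.span {(p : ℤ)}) v.asIdeal hne, hmap,
    ordAt_eq_ord]
  unfold Literature.IUT.LogVolume.ord
  rw [show (p : K) = algebraMap (𝓞 K) K ((p : ℕ) : 𝓞 K) by simp, HeightOneSpectrum.valuation_of_algebraMap,
    HeightOneSpectrum.intValuation_eq_exp_neg_multiplicity _ hp0, WithZero.log_exp, neg_neg]

/-- **`ord_v(n) = 0` for an integer `n` prime to `v`** (`n ∉ v`). [cite: NeukirchANT1999, Ch. I §11] -/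
theorem ordAt_intCast_eq_zero_of_not_mem (v : HeightOneSpectrum (𝓞 K)) {n : ℤ} (hn : n ≠ 0)
    (hv : ((n : ℤ) : 𝓞 K) ∉ v.asIdeal) : ordAt v (n : K) = 0 := by
  have h0 : ((n : ℤ) : 𝓞 K) ≠ 0 := by exact_mod_cast hn
  rw [show (n : K) = (((n : ℤ) : 𝓞 K) : K) by simp]
  exact (ordAt_eq_zero_iff_not_mem v h0).mpr hv

/-- **`ord_w(x) = e(w|v)·ord_v(x)`** for `w ∣ v` in an extension of number fields `K ⊆ L`
(`finBelow K L w = v`; the tree's `IUT.LogVolume.ord_algebraMap`). [cite: NeukirchANT1999, Ch. I §8] -/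
theorem ordAt_algebraMap (L : Type) [Field L] [NumberField L] [Algebra K L]
    (w : HeightOneSpectrum (𝓞 L)) (x : K) :
    ordAt w (algebraMap K L x) =
      Ideal.ramificationIdx' (Literature.IUT.LogVolume.finBelow K L w).asIdeal w.asIdeal *
        ordAt (Literature.IUT.LogVolume.finBelow K L w) x := by
  rw [ordAt_eq_ord, ordAt_eq_ord]
  exact Literature.IUT.LogVolume.ord_algebraMap K L w x

/-! ## §2 `differentExponentAt` is the multiplicity of `v` in `𝒟_{K/ℚ}` -/

/-- `count_v(J)` = the multiplicity of `v` in a non-zero integral ideal `J` (unique factorisation of ideals in a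
Dedekind domain: the exponent of `v` in `J`). [cite: NeukirchANT1999, Ch. I §3 Thm. (3.3) (prime factorisation of ideals)] -/
theorem count_coeIdeal_eq_multiplicity (v : HeightOneSpectrum (𝓞 K)) {J : Ideal (𝓞 K)} (hJ : J ≠ ⊥) :
    count K v (J : FractionalIdeal (𝓞 K)⁰ K) = multiplicity v.asIdeal J := by
  classical
  rw [count_coe K v (show J ≠ 0 from hJ)]
  have hfm : FiniteMultiplicity v.asIdeal J := FiniteMultiplicity.of_prime_left v.prime hJ
  have h : ((Associates.mk v.asIdeal).count (Associates.mk J).factors : ℕ∞) = emultiplicity v.asIdeal J := by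
    rw [UniqueFactorizationMonoid.emultiplicity_eq_count_normalizedFactors v.irreducible hJ, normalize_eq,
      Ideal.count_associates_factors_eq hJ v.isPrime v.ne_bot]
  rw [hfm.emultiplicity_eq_multiplicity] at h
  exact_mod_cast h

/-- **`differentExponentAt v` = the multiplicity of `v` in `differentIdeal ℤ (𝓞 K)`.**
[cite: NeukirchANT1999, Ch. III §2 (the different)] -/
theorem differentExponentAt_eq_multiplicity (v : HeightOneSpectrum (𝓞 K)) :
    differentExponentAt v = (multiplicity v.asIdeal (differentIdeal ℤ (𝓞 K)) : ℤ) := by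
  unfold differentExponentAt
  exact count_coeIdeal_eq_multiplicity v (Literature.IUT.LogVolume.differentIdeal_ne_bot' K)

/-- `d_v ≥ 0`. [cite: NeukirchANT1999, Ch. III §2] -/
theorem differentExponentAt_nonneg (v : HeightOneSpectrum (𝓞 K)) : 0 ≤ differentExponentAt v := by
  rw [differentExponentAt_eq_multiplicity]
  exact Nat.cast_nonneg _

/-! ## §3 `d_v = 0 ⟺ v` unramified over `ℤ` ⟺ `e(v|p) = 1` -/

/-- **Dedekind: `d_v = 0 ⟺ v` is unramified over `ℤ`.** [cite: NeukirchANT1999, Ch. III §2 Thm. (2.6)] -/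
theorem differentExponentAt_eq_zero_iff_isUnramifiedAt (v : HeightOneSpectrum (𝓞 K)) :
    differentExponentAt v = 0 ↔ Algebra.IsUnramifiedAt ℤ v.asIdeal := by
  rw [differentExponentAt_eq_multiplicity, Nat.cast_eq_zero, multiplicity_eq_zero]
  exact not_dvd_differentIdeal_iff

/-- **`d_v = 0 ⟺ e(v|p) = 1`** (unramified over `ℤ`; the residue field `𝔽_p` is perfect).
[cite: NeukirchANT1999, Ch. III §2 Thm. (2.6)] -/
theorem differentExponentAt_eq_zero_iff_ramificationIdx_eq_one (v : HeightOneSpectrum (𝓞 K)) :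
    differentExponentAt v = 0 ↔ v.asIdeal.ramificationIdx ℤ = 1 := by
  rw [differentExponentAt_eq_zero_iff_isUnramifiedAt, Ideal.ramificationIdx_eq_one_iff]

/-- `e(v|p) = 1 ⟹ d_v = 0`. [cite: NeukirchANT1999, Ch. III §2 Thm. (2.6)] -/
theorem differentExponentAt_eq_zero_of_ramificationIdx_eq_one (v : HeightOneSpectrum (𝓞 K))
    (he : v.asIdeal.ramificationIdx ℤ = 1) : differentExponentAt v = 0 :=
  (differentExponentAt_eq_zero_iff_ramificationIdx_eq_one v).mpr he

/-! ## §4 Tame quadratic ramification: `e(v|p) = 2`, `p` odd ⟹ `d_v = 1` -/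

/-- **Tame quadratic ramification: `e(v|p) = 2` at an odd prime `p` ⟹ `d_v = 1`.** Lower bound
`v^{e−1} ∣ 𝒟` (Mathlib `pow_sub_one_dvd_differentIdeal`), upper bound Ore–Hensel
`d_v ≤ e − 1 + e·v_p(e) = 1 + 2·0` (the tree's `IUT.LogVolume.multiplicity_differentIdeal_le_ore`).
[cite: NeukirchANT1999, Ch. III §2 Thm. (2.6)] [cite: SerreLocalFields1979, Ch. III §6 Prop. 13] -/
theorem differentExponentAt_eq_one_of_ramificationIdx_eq_two {p : ℕ} [hp : Fact p.Prime] (hp2 : p ≠ 2)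
    (v : HeightOneSpectrum (𝓞 K)) (hv : ((p : ℕ) : 𝓞 K) ∈ v.asIdeal)
    (he : v.asIdeal.ramificationIdx ℤ = 2) : differentExponentAt v = 1 := by
  rw [differentExponentAt_eq_multiplicity]
  -- upper bound (Ore)
  have hup := Literature.IUT.LogVolume.multiplicity_differentIdeal_le_ore K p v hv
  have hval : padicValNat p (v.asIdeal.ramificationIdx ℤ) = 0 := by
    rw [he]
    exact padicValNat.eq_zero_of_not_dvd (fun h ↦ hp2 ((Nat.prime_dvd_prime_iff_eq hp.out Nat.prime_two).mp h))
  rw [hval, he] at hup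
  -- lower bound (Mathlib): `v ^ (2 - 1) ∣ 𝒟`
  have hpZ : Prime (p : ℤ) := Nat.prime_iff_prime_int.mp hp.out
  haveI hmax : (Ideal.span {(p : ℤ)}).IsMaximal :=
    ((Ideal.span_singleton_prime hpZ.ne_zero).mpr hpZ).isMaximal (by simpa using hpZ.ne_zero)
  have hp0 : ((p : ℕ) : 𝓞 K) ≠ 0 := by exact_mod_cast hp.out.ne_zero
  have hmap : Ideal.map (algebraMap ℤ (𝓞 K)) (Ideal.span {(p : ℤ)}) = Ideal.span {((p : ℕ) : 𝓞 K)} := by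
    rw [Ideal.map_span, Set.image_singleton, map_natCast]
  have hne : Ideal.map (algebraMap ℤ (𝓞 K)) (Ideal.span {(p : ℤ)}) ≠ ⊥ := by
    rw [hmap, Ne, Ideal.span_singleton_eq_bot]
    exact hp0
  haveI := liesOver_span_of_natCast_mem hp.out v hv
  have hdvd2 : v.asIdeal ^ 2 ∣ Ideal.map (algebraMap ℤ (𝓞 K)) (Ideal.span {(p : ℤ)}) := by
    rw [← he, Ideal.IsDedekindDomain.ramificationIdx_eq_multiplicity (Ideal.span {(p : ℤ)}) v.asIdeal hne]
    exact pow_multiplicity_dvd _ _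
  have hlow : v.asIdeal ^ (2 - 1) ∣ differentIdeal ℤ (𝓞 K) :=
    pow_sub_one_dvd_differentIdeal ℤ v.asIdeal 2 (by simpa using hpZ.ne_zero) hdvd2
  rw [show (2 : ℕ) - 1 = 1 from rfl, pow_one] at hlow
  have hfm : FiniteMultiplicity v.asIdeal (differentIdeal ℤ (𝓞 K)) :=
    FiniteMultiplicity.of_prime_left v.prime (Literature.IUT.LogVolume.differentIdeal_ne_bot' K)
  have h1 : 1 ≤ multiplicity v.asIdeal (differentIdeal ℤ (𝓞 K)) := by
    rw [← pow_one v.asIdeal] at hlow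
    exact hfm.le_multiplicity_of_pow_dvd hlow
  omega

/-! ## §5 Tower step: `d_w(L/ℚ) = d_w(L/K) + e(w|v)·d_v(K/ℚ)`; unramified `w ∣ v` ⟹ `d_w = d_v` -/

section Tower

variable (L : Type) [Field L] [NumberField L] [Algebra K L]

/-- **Transitivity of the different, prime by prime: `d_w(L/ℚ) = mult_w 𝒟_{L/K} + e(w|v)·d_v(K/ℚ)`**
for `w ∣ v` (Mathlib `differentIdeal_eq_differentIdeal_mul_differentIdeal` and
`emultiplicity_map_eq_ramificationIdx'_mul`). [cite: NeukirchANT1999, Ch. III §2 Prop. (2.2)] -/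
theorem differentExponentAt_eq_add_mul (w : HeightOneSpectrum (𝓞 L)) (v : HeightOneSpectrum (𝓞 K))
    (hwv : w.asIdeal.under (𝓞 K) = v.asIdeal) :
    differentExponentAt w =
      (multiplicity w.asIdeal (differentIdeal (𝓞 K) (𝓞 L)) : ℤ) +
        Ideal.ramificationIdx' v.asIdeal w.asIdeal * differentExponentAt v := by
  classical
  haveI : w.asIdeal.LiesOver v.asIdeal := ⟨hwv.symm⟩
  have htrans := differentIdeal_eq_differentIdeal_mul_differentIdeal ℤ (𝓞 K) (𝓞 L)
  have hDK : differentIdeal ℤ (𝓞 K) ≠ ⊥ := Literature.IUT.LogVolume.differentIdeal_ne_bot' K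
  have hDLK : differentIdeal (𝓞 K) (𝓞 L) ≠ ⊥ := differentIdeal_ne_bot
  have hmapK : (differentIdeal ℤ (𝓞 K)).map (algebraMap (𝓞 K) (𝓞 L)) ≠ ⊥ :=
    Ideal.map_ne_bot_of_ne_bot hDK
  rw [differentExponentAt_eq_multiplicity, differentExponentAt_eq_multiplicity, htrans]
  have hfin₁ : FiniteMultiplicity w.asIdeal (differentIdeal (𝓞 K) (𝓞 L)) :=
    FiniteMultiplicity.of_prime_left w.prime hDLK
  have hfin₂ : FiniteMultiplicity w.asIdeal ((differentIdeal ℤ (𝓞 K)).map (algebraMap (𝓞 K) (𝓞 L))) :=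
    FiniteMultiplicity.of_prime_left w.prime hmapK
  have hfin₃ : FiniteMultiplicity v.asIdeal (differentIdeal ℤ (𝓞 K)) :=
    FiniteMultiplicity.of_prime_left v.prime hDK
  have hfin : FiniteMultiplicity w.asIdeal
      (differentIdeal (𝓞 K) (𝓞 L) * (differentIdeal ℤ (𝓞 K)).map (algebraMap (𝓞 K) (𝓞 L))) :=
    FiniteMultiplicity.of_prime_left w.prime (mul_ne_zero hDLK hmapK)
  have hmul : emultiplicity w.asIdeal
      (differentIdeal (𝓞 K) (𝓞 L) * (differentIdeal ℤ (𝓞 K)).map (algebraMap (𝓞 K) (𝓞 L))) =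
      emultiplicity w.asIdeal (differentIdeal (𝓞 K) (𝓞 L)) +
        emultiplicity w.asIdeal ((differentIdeal ℤ (𝓞 K)).map (algebraMap (𝓞 K) (𝓞 L))) :=
    emultiplicity_mul w.prime
  have hmap := Ideal.IsDedekindDomain.emultiplicity_map_eq_ramificationIdx'_mul (S := 𝓞 L) hDK
    v.irreducible w.irreducible w.ne_bot
  rw [hmap, hfin.emultiplicity_eq_multiplicity, hfin₁.emultiplicity_eq_multiplicity,
    hfin₃.emultiplicity_eq_multiplicity] at hmul
  have h : (multiplicity w.asIdeal
      (differentIdeal (𝓞 K) (𝓞 L) * (differentIdeal ℤ (𝓞 K)).map (algebraMap (𝓞 K) (𝓞 L))) : ℕ) =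
      multiplicity w.asIdeal (differentIdeal (𝓞 K) (𝓞 L)) +
        Ideal.ramificationIdx' v.asIdeal w.asIdeal * multiplicity v.asIdeal (differentIdeal ℤ (𝓞 K)) := by
    exact_mod_cast hmul
  rw [h]
  push_cast
  ring

/-- **Unramified tower step: if `L/K` is unramified at `w ∣ v` then `d_w(L/ℚ) = d_v(K/ℚ)`**
(`w ∤ 𝒟_{L/K}` and `e(w|v) = 1`). This is the step «`d_w(L/ℚ) = d_w(K_CM/ℚ)` above every `ℓ ∤ d_{K′}`»
of the (d2) recipe at `L = K_CM·K′`. [cite: NeukirchANT1999, Ch. III §2 Prop. (2.2) and Thm. (2.6)] -/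
theorem differentExponentAt_eq_of_isUnramifiedAt (w : HeightOneSpectrum (𝓞 L)) (v : HeightOneSpectrum (𝓞 K))
    (hwv : w.asIdeal.under (𝓞 K) = v.asIdeal) (hunr : Algebra.IsUnramifiedAt (𝓞 K) w.asIdeal) :
    differentExponentAt w = differentExponentAt v := by
  rw [differentExponentAt_eq_add_mul L w v hwv]
  have h0 : multiplicity w.asIdeal (differentIdeal (𝓞 K) (𝓞 L)) = 0 :=
    multiplicity_eq_zero.mpr (not_dvd_differentIdeal_iff.mpr hunr)
  haveI : w.asIdeal.LiesOver v.asIdeal := ⟨hwv.symm⟩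
  have he1 : Ideal.ramificationIdx' v.asIdeal w.asIdeal = 1 := by
    rw [Ideal.ramificationIdx'_eq_ramificationIdx v.asIdeal w.asIdeal v.ne_bot]
    exact Ideal.ramificationIdx_eq_one_iff.mpr hunr
  rw [h0, he1]
  simp

/-- The same with the unramifiedness hypothesis in the consumer's shape `e(w|v) = 1`
(`Ideal.ramificationIdx (𝓞 K)`). [cite: NeukirchANT1999, Ch. III §2] -/
theorem differentExponentAt_eq_of_ramificationIdx_eq_one (w : HeightOneSpectrum (𝓞 L))
    (v : HeightOneSpectrum (𝓞 K)) (hwv : w.asIdeal.under (𝓞 K) = v.asIdeal)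
    (he : w.asIdeal.ramificationIdx (𝓞 K) = 1) : differentExponentAt w = differentExponentAt v :=
  differentExponentAt_eq_of_isUnramifiedAt L w v hwv (Ideal.ramificationIdx_eq_one_iff.mp he)

end Tower

end Literature.NumberTheory.EllipticCurves

end
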